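import Summits.NavierStokesRegularity.NavierStokesRegularity.Theorems.ExtremiserTransienceTightOrChainChains
import Summits.NavierStokesRegularity.NavierStokesRegularity.Theorems.ExtremiserTransienceTightOrChainLedgerCount
import Summits.NavierStokesRegularity.NavierStokesRegularity.Theorems.ExtremiserTransienceNearExtremalTransiencePerFlowStubViolatorDissipation
import Summits.NavierStokesRegularity.NavierStokesRegularity.Theorems.ExtremiserTransienceNearExtremalTransiencePerFlowOfFilamentSelectionAllTime
import Summits.NavierStokesRegularity.NavierStokesRegularity.Theorems.ExtremiserTransienceBackwardConePropagation
import HarnessLib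

/-!
# Route `ExtremiserTransience`, crux `NearExtremalTransiencePerFlow` (stmt-NavierStokesRegularity-26567),
# LINE g10-β «tight-or-chain» — part C: THE CRUX FROM T♮ ∧ L1ᵘ BY NAME (L2, L3ˡᵒᶜ, the chain calculus and the propagation discharged)

`--supports stmt-NavierStokesRegularity-26567` (helper; Theorems-side port of §2 and §4 of the registered skeleton of record
`Cruxes/NearExtremalTransiencePerFlow/Lines/tight_or_chain.lean`, planner ns-idea-5 g10, sha 0c90497d1ce4, over the texts of record
`Theorems/ExtremiserTransienceTightOrChainDefs.lean` / `…DissipationLedgerDefs.lean`).  Port and discharge by prover seat `ns-net-p1` (g11).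

* `localChainLiouville_of_ledger` / `localChainLiouville_of` — L3ˡᵒᶜ (`ledgerCountLocal_holds`, part B) + L1ᵘ + L2 + the landed backward-cone
  propagation `ScrewSymmetricLiouville.exists_backwardCone_violator` ⇒ `LocalChainLiouville` (the author's composition);
* `localChainLiouville_of_uniformDissipationBudget : UniformDissipationBudget → LocalChainLiouville` — L2 DISCHARGED by the landed
  `DissipationLedger.stub_violatorDissipation` (p704994): the local chain Liouville theorem now depends on the ONE analytic stub L1ᵘ;
* `nearExtremalTransiencePerFlow_of_tightOrChain : TightOrChain → UniformDissipationBudget → NearExtremalTransiencePerFlow` — the β skeleton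
  by name in the tree (F1 `FilamentGap.flowFilamentBudget`, T0 `efficientTimesNoDust_holds`, T2′ `FilamentSelection.zoomPackageFlow`, growth
  `ballEnergy_zoom_le` / G′ `growthTransferFlow`, tight branch `not_isExtremalSlice_of_typeIAncientMild`, chain branch the local Liouville theorem);
  and the member-level entries `…_of_tightOrChainMembers`, `…_of_tightOrClusterGrowth`.

STATE OF ⟨26567⟩ BY KERNEL after this file: `NearExtremalTransiencePerFlow ⇐ TightOrChain ∧ UniformDissipationBudget` (both registered stubs:
T♮ heart, L1ᵘ analytic), and `⇐ TightOrChain` alone once L1ᵘ lands.  HONEST FRAMING: no stub is proved here beyond what is cited; the heart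
T♮, the crux and NS regularity stay OPEN; no summit is proved by a line. [folklore]
-/

noncomputable section

open scoped Topology InnerProductSpace RealInnerProductSpace ENNReal ContDiff
open MeasureTheory Filter Set Metric Function
open Literature.Analysis Literature.Analysis.FluidPDE
open Summit.NavierStokesRegularity.NavierStokesRegularity.Theses.ExtremiserTransience
open Summit.NavierStokesRegularity.NavierStokesRegularity.Theorems
open Summit.NavierStokesRegularity.NavierStokesRegularity.Theorems.DepletionLadder.KStar.HalfSpace
open Summit.NavierStokesRegularity.NavierStokesRegularity.Theorems.NearExtremalTransiencePerFlow.ZoneTransversality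
open Summit.NavierStokesRegularity.NavierStokesRegularity.Theorems.NearExtremalTransiencePerFlow.MemberSelection
open Summit.NavierStokesRegularity.NavierStokesRegularity.Theorems.NearExtremalTransiencePerFlow.DissipationLedger
open Summit.NavierStokesRegularity.NavierStokesRegularity.Theorems.NearExtremalTransiencePerFlow

namespace Summit.NavierStokesRegularity.NavierStokesRegularity.Theorems.NearExtremalTransiencePerFlow.TightOrChain

-- the problem directory repeats the summit name (`NavierStokesRegularity/NavierStokesRegularity`)
set_option linter.dupNamespace false

/-- **Local chain Liouville from the local ledger.**  Level `ε = min(ε₁, η√(-s)/2)`; radius `d = R₀` of L3ˡᵒᶜ; a negative thickness is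
vacuous (the line author's composition, ported). [folklore] -/
theorem localChainLiouville_of_ledger (h3 : LedgerCountLocal) (h1 : UniformDissipationBudget) (h2 : ViolatorDissipation) :
    LocalChainLiouville := by
  intro K A g η s hs hη
  by_cases hg : 0 ≤ g
  swap
  · refine ⟨1, one_pos, fun W z₀ _ _ hch => ?_⟩
    obtain ⟨z, hz, -⟩ := hch 0 le_rfl zero_le_one
    exact hg ((abs_nonneg _).trans hz)
  obtain ⟨ε₁, hε₁, hper⟩ := ScrewSymmetricLiouville.exists_backwardCone_violator
  have hsq : 0 < Real.sqrt (-s) := Real.sqrt_pos.2 (neg_pos.2 hs)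
  obtain ⟨ε, hε, hεε₁, hεη⟩ : ∃ ε : ℝ, 0 < ε ∧ ε ≤ ε₁ ∧ ε < η * Real.sqrt (-s) := by
    refine ⟨min ε₁ (η * Real.sqrt (-s) / 2), lt_min hε₁ (by positivity), min_le_left _ _, ?_⟩
    have h1 : η * Real.sqrt (-s) / 2 < η * Real.sqrt (-s) := half_lt_self (by positivity)
    exact lt_of_le_of_lt (min_le_right _ _) h1
  obtain ⟨ρ, hρ, hρW⟩ := hper ε hε hεε₁ K
  obtain ⟨c, D, a, hc, hD, ha, ha1, hsp⟩ := h2 K A ε hε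
  obtain ⟨E, hE⟩ := h1 K A
  obtain ⟨R₀, hR₀, hcount⟩ := h3 s g ρ c D a E hs hg hρ hc hD ha ha1
  refine ⟨R₀, hR₀, fun W z₀ hW hgr hch => ?_⟩
  refine hcount (dissMeasure W) (fun τ x => ε < Real.sqrt (-τ) * ‖W τ x‖) z₀ ?_ ?_ ?_ ?_
  · intro r hr hrR
    obtain ⟨z, hz, hzη⟩ := hch r hr hrR
    refine ⟨z, hz, ?_⟩
    show ε < Real.sqrt (-s) * ‖W s z‖
    calc ε < η * Real.sqrt (-s) := hεη
      _ = Real.sqrt (-s) * η := mul_comm _ _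
      _ ≤ Real.sqrt (-s) * ‖W s z‖ := by gcongr
  · intro τ x hτ hP
    exact hρW W hW τ hτ x hP
  · intro τ x hτ hP
    exact hsp W hW hgr τ x hτ hP
  · intro R τ₁ τ₂ hR h12 h2' hτR
    exact hE W hW hgr z₀ R τ₁ τ₂ hR h12 h2' hτR

/-- The local chain Liouville theorem from the two ANALYTIC statements L1ᵘ, L2 (L3ˡᵒᶜ = `ledgerCountLocal_holds`). [folklore] -/
theorem localChainLiouville_of (hL1 : UniformDissipationBudget) (hL2 : ViolatorDissipation) : LocalChainLiouville :=
  localChainLiouville_of_ledger ledgerCountLocal_holds hL1 hL2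

/-- **LOCAL CHAIN LIOUVILLE FROM L1ᵘ ALONE** — L2 discharged by the landed `DissipationLedger.stub_violatorDissipation` (p704994): for all
`K, A, g`, `η > 0`, `s < 0` there is `d > 0` such that no slice `W s` of a Type-I ancient mild field (constant `K`) with all-time linear growth
`A` carries a level-`η` chain of thickness `g` and length `d` about any centre — GIVEN the uniform dissipation budget L1ᵘ. [folklore] -/
theorem localChainLiouville_of_uniformDissipationBudget (hL1 : UniformDissipationBudget) : LocalChainLiouville :=
  localChainLiouville_of hL1 DissipationLedger.stub_violatorDissipation

/-- **THE CRUX FROM T♮ ∧ L1ᵘ BY NAME** (the LINE g10-β skeleton with L2 discharged, via the local chain Liouville theorem).  Violator frame by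
contradiction → F1 budget `A` (`flowFilamentBudget`) → T0 data (`efficientTimesNoDust_holds`) → T2′ zoom family + flow compactness
(`zoomPackageFlow`) → eventual growth of the members (`ballEnergy_zoom_le`) → T♮: centres, subsequence, limit `W₀`, dichotomy → flow
compactness at those centres: `W₀ = W s`, `W` Type-I ancient mild → G′ (`growthTransferFlow`): all-time growth → tight branch:
`not_isExtremalSlice_of_typeIAncientMild`; chain branch: `LocalChainLiouville` at the length `d(K,A,g,η,s)`. [folklore] -/
theorem nearExtremalTransiencePerFlow_of_tightOrChain (hT : TightOrChain) (hL1 : UniformDissipationBudget) :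
    NearExtremalTransiencePerFlow := by
  -- the local ledger's Liouville theorem from L1ᵘ (L2, L3ˡᵒᶜ and the backward-cone propagation are theorems)
  have hL : LocalChainLiouville := localChainLiouville_of_uniformDissipationBudget hL1
  have hT0 : EfficientTimesNoDust := efficientTimesNoDust_holds
  intro C ν T hC hν hT' u p hsol hLH hdec hrate hsing
  by_contra hno
  have hV : IsViolator C ν T u p := ⟨hC, hν, hT', hsol, hLH, hdec, hrate, hsing, hno⟩
  -- F1: the filament budget of the flow (landed)
  obtain ⟨A, hA⟩ := FilamentGap.flowFilamentBudget C ν T hC hν hT' u p hsol hLH hdec hrate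
  -- T0: near-efficient late times with a Taylor bound (landed)
  obtain ⟨Θ, t, Mb, ε, hdata⟩ := hT0 C ν T u p hV
  -- T2′: zoom family and flow-level compactness (landed)
  obtain ⟨σ, Λ, Θ', ε', hσ, hfam, hcompF⟩ := FilamentSelection.zoomPackageFlow C ν T u p hV Θ t Mb ε hdata
  -- the zoom family
  set V : ℕ → E3 → E3 := fun n z => (Mb (σ n))⁻¹ • u (t (σ n)) ((ν / Mb (σ n)) • z) with hVdef
  -- eventual growth of the members (F1 + scale invariance of the budget)
  have htT : Tendsto (fun n => t (σ n)) atTop (𝓝[<] T) := by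
    have h1 : Tendsto (fun n => t (σ n)) atTop (𝓝 T) := hdata.2.1.comp hσ.tendsto_atTop
    exact tendsto_nhdsWithin_iff.2 ⟨h1, Eventually.of_forall fun n => (hdata.1 (σ n)).2⟩
  have hgrV : ∀ᶠ n in atTop, ∀ (x : E3) (R : ℝ), 0 < R → ∫ z in Metric.ball x R, ‖V n z‖ ^ 2 ≤ A * R := by
    filter_upwards [htT.eventually hA] with n hn x R hR
    have h := FilamentSelection.ballEnergy_zoom_le hν (hdata.2.2.2.1 (σ n)) hn 0 x hR
    simpa only [zero_add] using h
  -- T♮: centres, subsequence, limit, dichotomy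
  obtain ⟨y, φ, W₀, hφ, hconv, hdich⟩ := hT V Λ Θ' ε' A hfam hgrV
  -- T2′ compactness at these centres
  obtain ⟨ψ, K, s, W, hψ, hW, hs, hpin, hconvF⟩ := hcompF y φ hφ
  -- the slice family is the instance `τ = s` of the flow-level convergence, so `W s = W₀`
  have hconv' : ∀ z : E3, Tendsto (fun n => V (φ (ψ n)) (y (φ (ψ n)) + z)) atTop (𝓝 (W s z)) := by
    intro z
    have h1 := hconvF s hs z
    simp only [sub_self, mul_zero, add_zero] at h1
    exact h1
  have hWs : W s = W₀ :=
    funext fun z => tendsto_nhds_unique (hconv' z) ((hconv z).comp hψ.tendsto_atTop)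
  subst hWs
  -- G′ at every rescaled time (landed)
  have htT' : Tendsto (fun n => t (σ (φ (ψ n)))) atTop (𝓝 T) :=
    hdata.2.1.comp ((hσ.comp (hφ.comp hψ)).tendsto_atTop)
  have hgrowthAll : HasLinGrowthAllTime A W := by
    intro τ hτ
    exact FilamentSelection.growthTransferFlow ν A T u (fun n => t (σ (φ (ψ n)))) (fun n => Mb (σ (φ (ψ n))))
      (fun n => y (φ (ψ n))) s τ (W τ) hν hT' (fun n => hdata.2.2.2.1 _) (fun n => (hdata.1 _).2) htT'
      (fun t' ht' => (hsol.contDiff_velocity ht').continuous) hA hs hpin hτ (hconvF τ hτ)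
  rcases hdich with hext | ⟨g, η, hη, hchain⟩
  · -- tight branch: an exactly extremal slice of a Type-I ancient mild field — excluded unconditionally (landed)
    exact not_isExtremalSlice_of_typeIAncientMild hW hs hext
  · -- chain branch: the local chain Liouville theorem at the length `d(K, A, g, η, s)`
    obtain ⟨d, -, hLd⟩ := hL K A g η s hs hη
    obtain ⟨z₀, hz₀⟩ := hchain d
    exact hLd W z₀ hW hgrowthAll hz₀

/-- The crux from the MEMBER-LEVEL heart T♮ₘₑₘ and L1ᵘ (limit passage `tightOrChain_of_members`). [folklore] -/
theorem nearExtremalTransiencePerFlow_of_tightOrChainMembers (hT : TightOrChainMembers) (hL1 : UniformDissipationBudget) :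
    NearExtremalTransiencePerFlow :=
  nearExtremalTransiencePerFlow_of_tightOrChain (tightOrChain_of_members hT) hL1

/-- The crux from CLUSTER GROWTH and L1ᵘ (walk lemma + limit passage `tightOrChain_of_clusterGrowth`). [folklore] -/
theorem nearExtremalTransiencePerFlow_of_tightOrClusterGrowth (hT : TightOrClusterGrowth) (hL1 : UniformDissipationBudget) :
    NearExtremalTransiencePerFlow :=
  nearExtremalTransiencePerFlow_of_tightOrChain (tightOrChain_of_clusterGrowth hT) hL1

end Summit.NavierStokesRegularity.NavierStokesRegularity.Theorems.NearExtremalTransiencePerFlow.TightOrChain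

end
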